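import Literature.Computation.Certificates.SemidefiniteRigorousBounds

/-!
# Factored ("few-squares") lower-bound certificates: the LMI-form rigorous bound with Gram-factor multipliers

Topic `Literature/Computation/Certificates`. A lower-bound certificate for a program in inequality (LMI /
"y-") form — objective `c·y + c₀`, unit variable `y_u = 1`, a-priori bounds `|y_v| ≤ ρ_v` (`v ≠ u`),
equality rows, inequality rows, PSD blocks `M_k(y) = C_k + Σ_v y_v F_{k,v} ⪰ 0` — whose PSD multipliers
are given NOT as matrices `Z_k` to be checked positive semidefinite, but as rectangular FACTORS `W_k`
(`Z_k := W_k W_kᵀ`, any number of columns): positivity then holds BY CONSTRUCTION, and the rigorous bound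
of Jansson–Chaykin–Keil in inequality form (`JanssonChaykinKeil.lmiForm_bound`, this directory) applies
with ALL eigenvalue-defect terms `d_k = 0` and hence without any trace bound on the unknown primal blocks.

This is the combination, recorded as a COROLLARY (not as a statement of either source), of

* C. Jansson, D. Chaykin, C. Keil, *Rigorous error bounds for the optimal value in semidefinite
  programming*, SIAM J. Numer. Anal. 46 (2007/08) 180–200 [JanssonChaykinKeil2008] — Lemma 3.1 and the
  mechanism of Theorem 3.2 (a-priori bounds on the unknown primal object turn ANY approximate dual point
  into a rigorous bound), here through `JanssonChaykinKeil.lmiForm_bound`;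
* S. Burer, R. D. C. Monteiro, *A nonlinear programming algorithm for solving semidefinite programs via
  low-rank factorization*, Math. Program. 95 (2003) 329–357 [BurerMonteiro2003], §1 eq. (2): the
  substitution `X = R Rᵀ` "builds positive semidefiniteness in" (Mathlib `Matrix.posSemidef_self_mul_conjTranspose`;
  the same fact is `BurerMonteiroOptimality.posSemidef_factor` in this directory).

What is proved (real symmetric data, arbitrary finite index types; block `k` has row index type `σ k` and
an arbitrary column index type `π k` for its factor — thin, square or wide factors alike):

* `FactoredCertificate.bound` — for EVERY feasible `y` and EVERY family of factors `W_k : σ k × π k` and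
  multipliers `λ` (free), `κ ≥ 0`: with the exact residuals
  `r_v = c_v − Σ_e λ_e row_e[v] + Σ_i κ_i row_i[v] − Σ_k ⟨W_k W_kᵀ, F_{k,v}⟩` and
  `β = c₀ + r_u + Σ_e λ_e rhs_e − Σ_i κ_i upper_i − Σ_k ⟨W_k W_kᵀ, C_k⟩`,
  `β − Σ_{v ≠ u} |r_v| ρ_v ≤ c·y + c₀` — the bound formula of a Gram-mode conic certificate
  (certsdp `RIGOR-LAYER.md` §2 / `certsdp-cert/0`: "G_b = L_b L_bᵀ is PSD by construction, any ragged
  integer factor is admissible"), i.e. the reader specification behind factored / Burer–Monteiro-type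
  dual searches: every iterate of such a search is a valid certificate, and reading it needs NO positive-
  semidefiniteness test (no LDLᵀ, no eigenvalue enclosure).
* `FactoredCertificate.bound_of_residual_eq_zero` — the exact-feasibility case `r_v = 0 (v ≠ u)`: plain
  weak duality `β ≤ c·y + c₀`.

No definitions, no named facts; everything is proved (two short corollaries).
-/

namespace Literature.Computation.Certificates

open Matrix Finset
open scoped BigOperators

namespace FactoredCertificate

variable {V : Type*} [Fintype V] [DecidableEq V] {E : Type*} [Fintype E] {I : Type*} [Fintype I]
variable {K : Type*} [Fintype K] {σ : K → Type*} [∀ k, Fintype (σ k)] [∀ k, DecidableEq (σ k)]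
variable {π : K → Type*} [∀ k, Fintype (π k)]

/-- **Rigorous lower bound from a FACTORED certificate (LMI form).** Data: objective `c·y + c₀` over
`y ∈ ℝ^V` with unit variable `y_u = 1`, a-priori bounds `|y_v| ≤ ρ_v` (`v ≠ u`), equality rows
`row_e · y = rhs_e`, inequality rows `row_i · y ≤ upper_i`, PSD blocks `M_k(y) = C_k + Σ_v y_v F_{k,v} ⪰ 0`.
Certificate: multipliers `λ_e` (free), `κ_i ≥ 0`, and for each block a FACTOR `W_k ∈ ℝ^{σ_k × π_k}` (the
multiplier is `Z_k := W_k W_kᵀ`, positive semidefinite by construction — no test needed). With the exact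
residuals `r_v = c_v − Σ_e λ_e row_e[v] + Σ_i κ_i row_i[v] − Σ_k tr (W_k W_kᵀ F_{k,v})` and
`β = c₀ + r_u + Σ_e λ_e rhs_e − Σ_i κ_i upper_i − Σ_k tr (W_k W_kᵀ C_k)`, every feasible `y` satisfies
`β − Σ_{v ≠ u} |r_v| ρ_v ≤ c·y + c₀`. (Proof: `JanssonChaykinKeil.lmiForm_bound` with `Z_k = W_k W_kᵀ`,
`d_k = 0` — so the trace-bound term vanishes whatever trace bound is supplied; we supply the trace itself.)
[cite: JanssonChaykinKeil2008, Lemma 3.1 and Thm 3.2 (inequality-form corollary)]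
[cite: BurerMonteiro2003, §1 eq. (2) (X = R Rᵀ is PSD by construction)] -/
theorem bound (c : V → ℝ) (c0 : ℝ) (u : V)
    (rowE : E → V → ℝ) (rhs : E → ℝ) (rowI : I → V → ℝ) (upper : I → ℝ)
    (Cb : ∀ k, Matrix (σ k) (σ k) ℝ) (F : ∀ k, V → Matrix (σ k) (σ k) ℝ) (ρ : V → ℝ)
    -- a feasible point
    {y : V → ℝ} (hyu : y u = 1) (hρ : ∀ v, v ≠ u → |y v| ≤ ρ v)
    (heq : ∀ e, ∑ v, rowE e v * y v = rhs e) (hineq : ∀ i, ∑ v, rowI i v * y v ≤ upper i)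
    (hpsd : ∀ k, (Cb k + ∑ v, y v • F k v).PosSemidef)
    -- the factored certificate
    (lam : E → ℝ) (κ : I → ℝ) (hκ : ∀ i, 0 ≤ κ i) (W : ∀ k, Matrix (σ k) (π k) ℝ)
    (r : V → ℝ)
    (hr : ∀ v, r v = c v - ∑ e, lam e * rowE e v + ∑ i, κ i * rowI i v
      - ∑ k, trace (W k * (W k)ᵀ * F k v))
    (β : ℝ)
    (hβ : β = c0 + r u + ∑ e, lam e * rhs e - ∑ i, κ i * upper i
      - ∑ k, trace (W k * (W k)ᵀ * Cb k)) :
    β - ∑ v ∈ Finset.univ.erase u, |r v| * ρ v ≤ ∑ v, c v * y v + c0 := by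
  have hZ : ∀ k, (W k * (W k)ᵀ - (0 : ℝ) • (1 : Matrix (σ k) (σ k) ℝ)).PosSemidef := by
    intro k
    rw [zero_smul, sub_zero]
    simpa only [conjTranspose_eq_transpose_of_trivial] using posSemidef_self_mul_conjTranspose (W k)
  have h := JanssonChaykinKeil.lmiForm_bound c c0 u rowE rhs rowI upper Cb F ρ
    (fun k => trace (Cb k + ∑ v, y v • F k v)) hyu hρ heq hineq hpsd (fun k => le_rfl)
    lam κ hκ (fun k => W k * (W k)ᵀ) (fun _ => 0) hZ r hr β hβ
  simpa only [min_self, abs_zero, zero_mul, Finset.sum_const_zero, sub_zero] using h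

/-- **Exact-feasibility case (plain weak duality with factored multipliers).** If the residuals vanish
off the unit variable, `r_v = 0` for `v ≠ u`, then `β ≤ c·y + c₀` for every feasible `y` — the bound
needs no a-priori box. [cite: JanssonChaykinKeil2008, Thm 3.2 (case B = ∅: weak duality)]
[cite: BurerMonteiro2003, §1 eq. (2)] -/
theorem bound_of_residual_eq_zero (c : V → ℝ) (c0 : ℝ) (u : V)
    (rowE : E → V → ℝ) (rhs : E → ℝ) (rowI : I → V → ℝ) (upper : I → ℝ)
    (Cb : ∀ k, Matrix (σ k) (σ k) ℝ) (F : ∀ k, V → Matrix (σ k) (σ k) ℝ)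
    {y : V → ℝ} (hyu : y u = 1)
    (heq : ∀ e, ∑ v, rowE e v * y v = rhs e) (hineq : ∀ i, ∑ v, rowI i v * y v ≤ upper i)
    (hpsd : ∀ k, (Cb k + ∑ v, y v • F k v).PosSemidef)
    (lam : E → ℝ) (κ : I → ℝ) (hκ : ∀ i, 0 ≤ κ i) (W : ∀ k, Matrix (σ k) (π k) ℝ)
    (r : V → ℝ)
    (hr : ∀ v, r v = c v - ∑ e, lam e * rowE e v + ∑ i, κ i * rowI i v
      - ∑ k, trace (W k * (W k)ᵀ * F k v))
    (hr0 : ∀ v, v ≠ u → r v = 0)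
    (β : ℝ)
    (hβ : β = c0 + r u + ∑ e, lam e * rhs e - ∑ i, κ i * upper i
      - ∑ k, trace (W k * (W k)ᵀ * Cb k)) :
    β ≤ ∑ v, c v * y v + c0 := by
  -- use the boxed bound with the (irrelevant) box ρ_v := |y_v|, whose charge vanishes since r_v = 0
  have h := bound c c0 u rowE rhs rowI upper Cb F (fun v => |y v|) hyu (fun v _ => le_rfl) heq hineq
    hpsd lam κ hκ W r hr β hβ
  have hsum : ∑ v ∈ Finset.univ.erase u, |r v| * |y v| = 0 := by
    refine Finset.sum_eq_zero fun v hv => ?_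
    rw [hr0 v (Finset.ne_of_mem_erase hv), abs_zero, zero_mul]
  rw [hsum, sub_zero] at h
  exact h

end FactoredCertificate

end Literature.Computation.Certificates
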